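import Literature.Topology.FourManifolds.FineStep
import HarnessLib

/-!
# Iterating the fine step along an expansion sequence

The inner induction of the engulfing engine (Rushing 1973, proof of Thm. 4.12.1: the passage
`IH(k, m-1, a) ⇒ IH(k, m, a)` iterated, here along the elementary expansions of one cell):
given, in a chart `ψ : E → M`, a finite sequence of image simplices `T_j` with apices `a_j`,
an increasing sequence of compact sets `C_j` (the images of the tracked polyhedra:
`C_{j+1} ⊆ C_j ∪ ψ(conv T_j)`, `ψ(horn_j) ⊆ C_j`), singular families with the separation
property of `FineStep.lean` for each `j`, and the inductive hypothesis on `r` available at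
every `e(U)`, `e` a homeomorphism of `M` — if `C_0 ⊆ H_0(U)` for a compactly supported
homeomorphism `H_0` fixed on `C_fix ⊆ C_0`, then there is a compactly supported homeomorphism
`H` fixed on `C_fix` with `C_J ⊆ H(U)` (`exists_homeomorph_expandSeq`).  Each step is
`exists_homeomorph_fineStep`.  Everything is proved; no definitions, no named facts.

## References

* T. B. Rushing, *Topological Embeddings*, Academic Press (1973), proof of Thm. 4.12.1
  (Facts 2–4 iterated). [Rushing1973]
-/

open Set Function Module Topology

noncomputable section

namespace Literature.Topology.FourManifolds

open Literature.Analysis.Convexity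

variable {E : Type*} [NormedAddCommGroup E] [NormedSpace ℝ E] [FiniteDimensional ℝ E]
  [DecidableEq E] {M : Type*} [TopologicalSpace M] [T2Space M]

/-- **Iterated fine steps.** See the module docstring.
[cite: Rushing1973, proof of Thm. 4.12.1 (the induction `IH(k, m-1, a) ⇒ IH(k, m, a)`)] -/
theorem exists_homeomorph_expandSeq {n r : ℕ} (hr : r + 3 ≤ n)
    (ψ : E → M) (hψ : IsOpenEmbedding ψ) (U : Set M) (hU : IsOpen U)
    (hIH : ∀ (e₀ : M ≃ₜ M) (KP : Geometry.SimplicialComplex ℝ E) (_ : KP.faces.Finite)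
      (KQ : Set (Finset E)) (_ : KQ ⊆ KP.faces) (_ : ∀ s ∈ KQ, ∀ t ⊆ s, t.Nonempty → t ∈ KQ)
      (_ : ∀ s ∈ KP.faces, s.card ≤ n - 2) (_ : ∀ s ∈ KP.faces, s ∉ KQ → s.card ≤ r)
      (_ : ψ '' facesSpace KQ ⊆ e₀ '' U) (C' : Set M) (_ : IsCompact C') (_ : C' ⊆ e₀ '' U),
      ∃ e : M ≃ₜ M, (∀ x ∈ ψ '' facesSpace KQ ∪ C', e x = x) ∧
        (∃ E₀ : Set M, IsCompact E₀ ∧ ∀ x, x ∉ E₀ → e x = x) ∧ ψ '' KP.space ⊆ e '' (e₀ '' U))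
    (W₁ : Set M) (hW₁ : IsOpen W₁)
    (J : ℕ) (T : ℕ → Finset E) (apex : ℕ → E)
    (hT : ∀ j < J, AffineIndependent ℝ ((↑) : T j → E)) (ha : ∀ j < J, apex j ∈ T j)
    (hB : ∀ j < J, ((T j).erase (apex j)).Nonempty)
    (hTW : ∀ j < J, ψ '' convexHull ℝ (T j : Set E) ⊆ W₁)
    (Cseq : ℕ → Set M) (hCcpt : ∀ j ≤ J, IsCompact (Cseq j))
    (hCmono : ∀ j < J, Cseq j ⊆ Cseq (j + 1))
    (hCsucc : ∀ j < J, Cseq (j + 1) ⊆ Cseq j ∪ ψ '' convexHull ℝ (T j : Set E))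
    (hChorn : ∀ j < J, ψ '' simplexHorn (T j) (apex j) ⊆ Cseq j)
    (κ : ℕ → Type*) [∀ j, Fintype (κ j)] (A : ∀ j, κ j → AffineSubspace ℝ E)
    (hA : ∀ j < J, ∀ ℓ, (A j ℓ : Set E).Nonempty → finrank ℝ (A j ℓ).direction + 2 ≤ r)
    (hsep : ∀ j < J, ∀ y ∈ convexHull ℝ (T j : Set E), ψ y ∈ Cseq j →
      y ∈ simplexHorn (T j) (apex j) ∨ ∃ ℓ, y ∈ A j ℓ)
    (Cfix : Set M) (hCfix0 : Cfix ⊆ Cseq 0)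
    (H₀ : M ≃ₜ M) (hH₀fix : ∀ x ∈ Cfix, H₀ x = x)
    (hH₀supp : ∃ E₀ : Set M, IsCompact E₀ ∧ ∀ x, x ∉ E₀ → H₀ x = x)
    (hH₀cov : Cseq 0 ⊆ H₀ '' U) :
    ∃ H : M ≃ₜ M, (∀ x ∈ Cfix, H x = x) ∧ (∃ E₀ : Set M, IsCompact E₀ ∧ ∀ x, x ∉ E₀ → H x = x) ∧
      Cseq J ⊆ H '' U := by
  -- `Cfix ⊆ Cseq j` for all `j ≤ J`
  have hCfixj : ∀ j ≤ J, Cfix ⊆ Cseq j := by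
    intro j
    induction j with
    | zero => exact fun _ => hCfix0
    | succ j ih => exact fun hj => (ih (Nat.le_of_succ_le hj)).trans (hCmono j (Nat.lt_of_succ_le hj))
  -- induction on the number of steps performed
  suffices hind : ∀ j ≤ J, ∃ H : M ≃ₜ M, (∀ x ∈ Cfix, H x = x) ∧
      (∃ E₀ : Set M, IsCompact E₀ ∧ ∀ x, x ∉ E₀ → H x = x) ∧ Cseq j ⊆ H '' U from hind J le_rfl
  intro j
  induction j with
  | zero => exact fun _ => ⟨H₀, hH₀fix, hH₀supp, hH₀cov⟩
  | succ j ih =>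
      intro hj
      have hjJ : j < J := Nat.lt_of_succ_le hj
      obtain ⟨H, hHfix, ⟨EH, hEH, hHsupp⟩, hHcov⟩ := ih hjJ.le
      -- the fine step at `U₀ = H(U)` with the fixed compact set `Cseq j`
      have hU₀ : IsOpen (H '' U) := H.isOpenMap U hU
      obtain ⟨H₁, hH₁fix, ⟨E₁, hE₁, hH₁supp⟩, hH₁cov⟩ :=
        exists_homeomorph_fineStep hr ψ hψ (H '' U) hU₀ (hIH H) (Cseq j) (hCcpt j hjJ.le) hHcov
          W₁ hW₁ (hT j hjJ) (ha j hjJ) (hB j hjJ) (hTW j hjJ) (A j) (hA j hjJ) (hsep j hjJ)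
          (hChorn j hjJ)
      refine ⟨H.trans H₁, fun x hx => ?_, ⟨EH ∪ E₁, hEH.union hE₁, fun x hx => ?_⟩, ?_⟩
      · rw [Homeomorph.trans_apply, hHfix x hx, hH₁fix x (hCfixj j hjJ.le hx)]
      · rw [mem_union, not_or] at hx
        rw [Homeomorph.trans_apply, hHsupp x hx.1, hH₁supp x hx.2]
      · intro x hx
        rcases hCsucc j hjJ hx with hx' | hx'
        · -- old tracked points are fixed by `H₁` and lie in `H(U)`
          obtain ⟨u, hu, hux⟩ := hHcov hx'
          refine ⟨u, hu, ?_⟩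
          rw [Homeomorph.trans_apply, hux, hH₁fix x hx']
        · obtain ⟨v, hv, hvx⟩ := hH₁cov hx'
          obtain ⟨u, hu, rfl⟩ := hv
          exact ⟨u, hu, by rw [Homeomorph.trans_apply]; exact hvx⟩

end Literature.Topology.FourManifolds
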